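import Summits.QuantumFields.YangMills.Theorems.BalabanUVNodesN15KingModelAnalyticDeterminantRealSlice
import Summits.QuantumFields.YangMills.Theorems.BalabanUVNodesN15KingModelCombesThomasEngine
import Literature.LinearAlgebra.Matrix.ChordalMaximumDeterminantCompletion
import Literature.LinearAlgebra.Matrix.PosDefHermitianPairDiagonalization
import HarnessLib

/-!
# BalabanUVNodes ∕ N15 — THE KING-MODEL RUNG (PART Ϭ-f): THE FIRST-ORDER RESPONSE OF THE BLOCK-FIELD VACUUM ENERGY — KING's (3.96) AT `n = 1` (`ln det(I + D) ≤ tr D`) AT BOTH ENDS: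
# `Re tr(C(U)·[Δ_eff(U) − Δ_eff(V)]) ≤ ln det Δ_eff(U) − ln det Δ_eff(V) ≤ Re tr(C(V)·[Δ_eff(U) − Δ_eff(V)])` for ANY two unitary backgrounds (concavity of `ln det` on the positive cone,
# Literature `ChordalSparsity.log_det_sub_log_det_le` [VandenbergheBoydWu1998]), strict unless `Δ_eff(U) = Δ_eff(V)`; the trace term is `≤ N·(a⁻¹+m⁻²)·‖Δ_eff(U) − Δ_eff(V)‖` so the Lipschitz law of
# PART Ϭ-d holds over EVERY `RCLike` fibre field; and the vacuum energy is CONCAVE along segments of effective Laplacians ([HornJohnson2013] Thm 7.6.6 (7.6.7), Literature `logDet_convex_combination_ge`)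
# (Track A, DAG node N15 = NE2; FAN-OUT v1.1 §N15 s3 «KING-MODEL RUNG … + what the curved case adds»; count-neutral)

HONEST FRAMING.  Count-neutral (cell `pub-ymgap`, seat `pub-ymgap-dag-n15-e` g53; `--supports stmt-QuantumFields-27247 --as helper` = K3ᴬ, KEY MAP v3).  King's one-level comparison model on
the real slice (unitary backgrounds, any `RCLike` fibre field, nonempty fibre), `a, m² > 0`, `c ≥ 0`; the SHAPE of King's (3.95)–(3.96) first-order term `tr[V G]` for the model's block-field
operators — NOT King's loop expansion (3.97)–(3.98), NOT Ward identities; the `pub-balaban` cell's real-matrix volume law `T4LogDetOscillation.abs_log_det_sub_log_det_le` (ℓ¹-entry currency) is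
the companion statement (cited, not used).  NOT Bałaban's multi-level objects; NOT a node discharge (N15 of record untouched); nothing continuum ∕ ℝ⁴ ∕ OS ∕ Clay.

THE RESULTS (unitary `U, V`; `a, m² > 0`, `c ≥ 0`; `N = |T₁|·|n|`; `C = (Δ_eff)⁻¹`, `E = Δ_eff(U) − Δ_eff(V)`):
* §1 (generic tools on the block lattice) `re_trace_inv_mul_self_sub` (`Re tr(W⁻¹(W′)) − N = Re tr(W⁻¹(W′ − W))` for invertible `W`), ★ `abs_re_trace_le` (`|Re tr X| ≤ N·‖X‖`),
  ★ `abs_re_trace_mul_le` (`|Re tr(XY)| ≤ N·‖X‖·‖Y‖`).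
* §2 ★★★ **`log_det_effLapU_sub_le_re_trace`** (`ln det Δ_eff(U) − ln det Δ_eff(V) ≤ Re tr(C(V)·E)` — KING's (3.96) at `n = 1`), ★★★ **`re_trace_le_log_det_effLapU_sub`** (`Re tr(C(U)·E) ≤ …`),
  ★★★★ **`king_first_order_response_sandwich`** (both), ★★ `effLapU_eq_of_log_det_sub_eq_re_trace` (equality at the upper end forces `Δ_eff(U) = Δ_eff(V)`),
  ★★★ **`abs_log_det_effLapU_sub_le_opNorm`** (`|ln det Δ_eff(U) − ln det Δ_eff(V)| ≤ N·(a⁻¹+m⁻²)·‖E‖` over EVERY `RCLike` fibre field — PART Ϭ-d's law without `𝕜 = ℂ`).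
* §3 ★★★ **`log_det_effLapU_segment_ge`** (`0 < α < 1`: `α·ln det Δ_eff(U) + (1−α)·ln det Δ_eff(V) ≤ ln det(αΔ_eff(U) + (1−α)Δ_eff(V))` — the block-field vacuum energy is CONCAVE along segments of
  effective Laplacians; Ky Fan ∕ [HJ] (7.6.7)), ★★ `log_det_effLapU_segment_eq_iff` (equality iff `Δ_eff(U) = Δ_eff(V)`).
PRIOR TREE ART (by name): Literature `ChordalSparsity.log_det_sub_log_det_le` ([VandenbergheBoydWu1998] (3.2)), `logDet_convex_combination_ge` ∕ `_eq_iff` ([HJ] Thm 7.6.6), Ϭ-b (`posDef_effLapU`), Ϫ-l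
(`effLapU_mul_inv_effLapU`, `inv_effLapU_mul_effLapU`), Ϫ-c (`l2_opNorm_effLapU_inv_le`), Ϧ-b (`norm_entry_le_opNorm`), `pub-balaban` `T4LogDetOscillation` (real volume law; cited), Mathlib (`Matrix.l2_opNorm_mul`,
`Matrix.trace`).  Dedup (rg at filing): basename 0 files; needles `king_first_order_response_sandwich|log_det_effLapU_sub_le_re_trace|abs_log_det_effLapU_sub_le_opNorm|log_det_effLapU_segment_ge|abs_re_trace_mul_le` 0 tree files.
Locators: [King1986] (2.14) p.653, (3.89)–(3.90) pp.668–669, (3.94)–(3.97) p.669, (4.33) p.674; [VandenbergheBoydWu1998] §3 eq. (3.2); [HornJohnson2013] Thm 7.6.6 (7.6.7) §7.6 (held chunk p0598).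
0 `sorry`, 0 `def`.
-/

noncomputable section
open scoped BigOperators ComplexConjugate ComplexOrder Matrix.Norms.L2Operator
open Finset Matrix WithLp

namespace Summit.QuantumFields.YangMills.BalabanUVNodes.N15KingModelRung.Analytic

open Literature.MathematicalPhysics.QuantumFieldTheory.Balaban1983to89.B5Prop11Plancherel (Tor fine)
open Literature.LinearAlgebra.Matrix (logDet_convex_combination_ge logDet_convex_combination_eq_iff)
open Literature.LinearAlgebra.Matrix.ChordalSparsity (log_det_sub_log_det_le)
open Summit.QuantumFields.YangMills.BalabanUVNodes.N15KingModelRung.CovariantBlock (BlockTree effLapU isUnit_effLapU)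
open Summit.QuantumFields.YangMills.BalabanUVNodes.N15KingModelRung.CombesThomas (norm_entry_le_opNorm)

variable {d : ℕ} {L : ℕ} [NeZero L] (T : BlockTree d L) (M : Fin (d + 1) → ℕ) [hM : ∀ μ, NeZero (M μ)]
variable {𝕜 : Type*} [RCLike 𝕜] {n : Type*} [Fintype n] [DecidableEq n]

/-! ## §1 Trace tools on the block lattice -/

section Tools

omit [NeZero L] in
/-- `Re tr(W⁻¹W′) − N = Re tr(W⁻¹(W′ − W))` for invertible `W`. [folklore] -/
theorem re_trace_inv_mul_self_sub {W W' : Matrix (Tor M × n) (Tor M × n) 𝕜} (hW : IsUnit W) :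
    RCLike.re ((W⁻¹ * W').trace) - Fintype.card (Tor M × n) = RCLike.re ((W⁻¹ * (W' - W)).trace) := by
  have hWdet : IsUnit W.det := (Matrix.isUnit_iff_isUnit_det _).mp hW
  rw [Matrix.mul_sub, Matrix.nonsing_inv_mul _ hWdet, Matrix.trace_sub, Matrix.trace_one, map_sub, RCLike.natCast_re]

omit [NeZero L] in
/-- ★ `|Re tr X| ≤ N·‖X‖` (each diagonal entry is bounded by the operator norm). [folklore] -/
theorem abs_re_trace_le (X : Matrix (Tor M × n) (Tor M × n) 𝕜) : |RCLike.re X.trace| ≤ Fintype.card (Tor M × n) * ‖X‖ := by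
  rw [Matrix.trace, map_sum]
  calc |∑ p, RCLike.re (Matrix.diag X p)| ≤ ∑ p, |RCLike.re (Matrix.diag X p)| := Finset.abs_sum_le_sum_abs _ _
    _ ≤ ∑ _p : Tor M × n, ‖X‖ := Finset.sum_le_sum fun p _ => by
        rw [Matrix.diag_apply]
        obtain ⟨y, i⟩ := p
        exact (RCLike.abs_re_le_norm _).trans (norm_entry_le_opNorm M X y y i i)
    _ = Fintype.card (Tor M × n) * ‖X‖ := by rw [Finset.sum_const, Finset.card_univ, nsmul_eq_mul]

omit [NeZero L] in
/-- ★ `|Re tr(XY)| ≤ N·‖X‖·‖Y‖`. [folklore] -/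
theorem abs_re_trace_mul_le (X Y : Matrix (Tor M × n) (Tor M × n) 𝕜) : |RCLike.re (X * Y).trace| ≤ Fintype.card (Tor M × n) * (‖X‖ * ‖Y‖) :=
  (abs_re_trace_le M (X * Y)).trans (mul_le_mul_of_nonneg_left (Matrix.l2_opNorm_mul X Y) (Nat.cast_nonneg _))

end Tools

/-! ## §2 King's (3.96) at `n = 1`, at both ends: the first-order response sandwich -/

section Response

variable [Nonempty n] {a c m2 : ℝ} (ha : 0 < a) (hc : 0 ≤ c) (hm : 0 < m2)
variable {U V : Tor (fine L M) × Fin (d + 1) → Matrix n n 𝕜} (hU : ∀ bd, U bd ∈ Matrix.unitaryGroup n 𝕜) (hV : ∀ bd, V bd ∈ Matrix.unitaryGroup n 𝕜)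
include ha hc hm hU hV

/-- ★★★ **KING's (3.96) AT `n = 1` (`ln det(I+D) ≤ tr D`)**: `ln det Δ_eff(U) − ln det Δ_eff(V) ≤ Re tr(C(V)·[Δ_eff(U) − Δ_eff(V)])` for any two unitary backgrounds — concavity of `ln det` on the
positive cone. [cite: King1986, (3.94)–(3.96) p.669, (2.14) p.653; VandenbergheBoydWu1998, §3 eq. (3.2)] -/
theorem log_det_effLapU_sub_le_re_trace :
    Real.log (RCLike.re (effLapU T M a c m2 U).det) - Real.log (RCLike.re (effLapU T M a c m2 V).det)
      ≤ RCLike.re (((effLapU T M a c m2 V)⁻¹ * (effLapU T M a c m2 U - effLapU T M a c m2 V)).trace) := by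
  have h := (log_det_sub_log_det_le (posDef_effLapU T M ha hc hm hV) (posDef_effLapU T M ha hc hm hU)).1
  rw [← re_trace_inv_mul_self_sub M (isUnit_effLapU T M ha hc hm hV)]
  exact h

/-- ★★★ **… AND AT THE OTHER END**: `Re tr(C(U)·[Δ_eff(U) − Δ_eff(V)]) ≤ ln det Δ_eff(U) − ln det Δ_eff(V)`. [cite: King1986, (3.94)–(3.96) p.669; VandenbergheBoydWu1998, §3 eq. (3.2)] -/
theorem re_trace_le_log_det_effLapU_sub :
    RCLike.re (((effLapU T M a c m2 U)⁻¹ * (effLapU T M a c m2 U - effLapU T M a c m2 V)).trace)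
      ≤ Real.log (RCLike.re (effLapU T M a c m2 U).det) - Real.log (RCLike.re (effLapU T M a c m2 V).det) := by
  have h := log_det_effLapU_sub_le_re_trace T M ha hc hm hV hU
  have e : (effLapU T M a c m2 U)⁻¹ * (effLapU T M a c m2 U - effLapU T M a c m2 V) = -((effLapU T M a c m2 U)⁻¹ * (effLapU T M a c m2 V - effLapU T M a c m2 U)) := by
    rw [← Matrix.mul_neg, neg_sub]
  rw [e, Matrix.trace_neg, map_neg]
  linarith

/-- ★★★★ **THE FIRST-ORDER RESPONSE SANDWICH OF THE BLOCK-FIELD VACUUM ENERGY**: for any two unitary backgrounds,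
`Re tr(C(U)E) ≤ ln det Δ_eff(U) − ln det Δ_eff(V) ≤ Re tr(C(V)E)`, `E = Δ_eff(U) − Δ_eff(V)`, `C = (Δ_eff)⁻¹` — the change of King's `−2·ln N` ((3.89)–(3.90)) is squeezed between the two
first-order terms `tr[CE]` of his expansion (3.96)–(3.97). [cite: King1986, (3.89)–(3.90) pp.668–669, (3.94)–(3.97) p.669; VandenbergheBoydWu1998, §3 eq. (3.2)] -/
theorem king_first_order_response_sandwich :
    RCLike.re (((effLapU T M a c m2 U)⁻¹ * (effLapU T M a c m2 U - effLapU T M a c m2 V)).trace)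
        ≤ Real.log (RCLike.re (effLapU T M a c m2 U).det) - Real.log (RCLike.re (effLapU T M a c m2 V).det)
      ∧ Real.log (RCLike.re (effLapU T M a c m2 U).det) - Real.log (RCLike.re (effLapU T M a c m2 V).det)
        ≤ RCLike.re (((effLapU T M a c m2 V)⁻¹ * (effLapU T M a c m2 U - effLapU T M a c m2 V)).trace) :=
  ⟨re_trace_le_log_det_effLapU_sub T M ha hc hm hU hV, log_det_effLapU_sub_le_re_trace T M ha hc hm hU hV⟩

/-- ★★ **STRICTNESS**: equality at the upper end of the sandwich forces `Δ_eff(U) = Δ_eff(V)` (strict concavity of `ln det`). [cite: VandenbergheBoydWu1998, §3 Thm 3.1 (remark); King1986, (3.96) p.669] -/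
theorem effLapU_eq_of_log_det_sub_eq_re_trace
    (heq : Real.log (RCLike.re (effLapU T M a c m2 U).det) - Real.log (RCLike.re (effLapU T M a c m2 V).det)
      = RCLike.re (((effLapU T M a c m2 V)⁻¹ * (effLapU T M a c m2 U - effLapU T M a c m2 V)).trace)) :
    effLapU T M a c m2 U = effLapU T M a c m2 V := by
  have h := (log_det_sub_log_det_le (posDef_effLapU T M ha hc hm hV) (posDef_effLapU T M ha hc hm hU)).2
  apply h
  rw [re_trace_inv_mul_self_sub M (isUnit_effLapU T M ha hc hm hV)]
  exact heq

/-- ★★★ **THE LIPSCHITZ LAW OVER EVERY FIBRE FIELD** (any tree contour system, any depth bound `D`): `|ln det Δ_eff(U) − ln det Δ_eff(V)| ≤ N·(a⁻¹+m⁻²)·‖Δ_eff(U) − Δ_eff(V)‖` — the sandwich plus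
`|Re tr(CE)| ≤ N‖C‖‖E‖` and PART Ϫ-c's `‖C‖ ≤ a⁻¹+m⁻²`; PART Ϭ-d proved this for `𝕜 = ℂ` by the multiplicative route. [cite: King1986, (2.14) p.653, (3.89)–(3.90) pp.668–669, (3.96) p.669, (4.33) p.674] -/
theorem abs_log_det_effLapU_sub_le_opNorm {D : ℕ} (hD : ∀ j, T.depth j ≤ D) :
    |Real.log (RCLike.re (effLapU T M a c m2 U).det) - Real.log (RCLike.re (effLapU T M a c m2 V).det)|
      ≤ Fintype.card (Tor M × n) * ((a⁻¹ + m2⁻¹) * ‖effLapU T M a c m2 U - effLapU T M a c m2 V‖) := by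
  obtain ⟨h1, h2⟩ := king_first_order_response_sandwich T M ha hc hm hU hV
  set E := effLapU T M a c m2 U - effLapU T M a c m2 V with hE
  have hN : (0 : ℝ) ≤ Fintype.card (Tor M × n) := Nat.cast_nonneg _
  have hCU : ‖(effLapU T M a c m2 U)⁻¹‖ ≤ a⁻¹ + m2⁻¹ := l2_opNorm_effLapU_inv_le T M hD ha hc hm hU
  have hCV : ‖(effLapU T M a c m2 V)⁻¹‖ ≤ a⁻¹ + m2⁻¹ := l2_opNorm_effLapU_inv_le T M hD ha hc hm hV
  have tU := abs_re_trace_mul_le M (effLapU T M a c m2 U)⁻¹ E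
  have tV := abs_re_trace_mul_le M (effLapU T M a c m2 V)⁻¹ E
  have bU : Fintype.card (Tor M × n) * (‖(effLapU T M a c m2 U)⁻¹‖ * ‖E‖) ≤ Fintype.card (Tor M × n) * ((a⁻¹ + m2⁻¹) * ‖E‖) :=
    mul_le_mul_of_nonneg_left (mul_le_mul_of_nonneg_right hCU (norm_nonneg _)) hN
  have bV : Fintype.card (Tor M × n) * (‖(effLapU T M a c m2 V)⁻¹‖ * ‖E‖) ≤ Fintype.card (Tor M × n) * ((a⁻¹ + m2⁻¹) * ‖E‖) :=
    mul_le_mul_of_nonneg_left (mul_le_mul_of_nonneg_right hCV (norm_nonneg _)) hN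
  rw [abs_le]
  constructor
  · have := (abs_le.mp (tU.trans bU)).1
    linarith
  · have := (abs_le.mp (tV.trans bV)).2
    linarith

end Response

/-! ## §3 Concavity along segments of effective Laplacians -/

section Segment

variable [Nonempty n] {a c m2 : ℝ} (ha : 0 < a) (hc : 0 ≤ c) (hm : 0 < m2)
variable {U V : Tor (fine L M) × Fin (d + 1) → Matrix n n 𝕜} (hU : ∀ bd, U bd ∈ Matrix.unitaryGroup n 𝕜) (hV : ∀ bd, V bd ∈ Matrix.unitaryGroup n 𝕜)
include ha hc hm hU hV

/-- ★★★ **THE BLOCK-FIELD VACUUM ENERGY IS CONCAVE ALONG SEGMENTS OF EFFECTIVE LAPLACIANS**: `0 < α < 1` ⟹ `α·ln det Δ_eff(U) + (1−α)·ln det Δ_eff(V) ≤ ln det(α·Δ_eff(U) + (1−α)·Δ_eff(V))`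
(Ky Fan's inequality ∕ [HJ] Thm 7.6.6 (7.6.7), Literature `logDet_convex_combination_ge`). [cite: HornJohnson2013, Thm 7.6.6 (7.6.7) §7.6 (held chunk p0598); King1986, (3.89)–(3.90) pp.668–669] -/
theorem log_det_effLapU_segment_ge {α : ℝ} (hα0 : 0 < α) (hα1 : α < 1) :
    α * Real.log (RCLike.re (effLapU T M a c m2 U).det) + (1 - α) * Real.log (RCLike.re (effLapU T M a c m2 V).det)
      ≤ Real.log (RCLike.re (((α : 𝕜) • effLapU T M a c m2 U + ((1 - α : ℝ) : 𝕜) • effLapU T M a c m2 V).det)) :=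
  logDet_convex_combination_ge (posDef_effLapU T M ha hc hm hU) (posDef_effLapU T M ha hc hm hV) hα0 hα1

/-- ★★ **… STRICTLY, unless the two effective Laplacians coincide**. [cite: HornJohnson2013, Thm 7.6.6 §7.6 (held chunk p0598); King1986, (3.90) p.669] -/
theorem log_det_effLapU_segment_eq_iff {α : ℝ} (hα0 : 0 < α) (hα1 : α < 1) :
    α * Real.log (RCLike.re (effLapU T M a c m2 U).det) + (1 - α) * Real.log (RCLike.re (effLapU T M a c m2 V).det)
        = Real.log (RCLike.re (((α : 𝕜) • effLapU T M a c m2 U + ((1 - α : ℝ) : 𝕜) • effLapU T M a c m2 V).det))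
      ↔ effLapU T M a c m2 U = effLapU T M a c m2 V :=
  logDet_convex_combination_eq_iff (posDef_effLapU T M ha hc hm hU) (posDef_effLapU T M ha hc hm hV) hα0 hα1

end Segment

end Summit.QuantumFields.YangMills.BalabanUVNodes.N15KingModelRung.Analytic

end
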